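import Summits.ResolutionOfSingularities.ResolutionOfSingularities.Theorems.EquisingularLiftEquisingularLiftNatNoseChart
import Summits.ResolutionOfSingularities.ResolutionOfSingularities.Theorems.EquisingularLiftEquisingularLiftNatStrictTransformComap
import Literature.AlgebraicGeometry.Resolution.PointBlowupHsFunMono
import Literature.AlgebraicGeometry.Resolution.SNCStrataSmooth
import HarnessLib

/-!
# [OURS · L1 W4.5(b) · EL♮(3) · door ν4, D7 brick HNODE, core P6] THE TRACE OF THE STRICT TRANSFORM OF THE EQUINODAL NOSE
# through the blow-up of one node section — TOOLS for `hTrace` of ✓ `Equinodal.hnode_rPlus_of_trace`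

res-L1-w45b-stub-2 g17 (HNODE pen). `--supports stmt-ResolutionOfSingularities-20148 --as helper`, no claim, counted 0. OURS; NOT a statement of
[Hironaka2017]; AI-written, weaker than expert review. EL♮(3) is NOT proved here; char-p resolution is NOT proved anywhere in this tree. DEF-FREE.

Ring-level and point-level tools for P6 (`…NatNoseTrace`): the NOSE FORM `Φ₂ = aT₁² + bT₁T₂ + cT₂²` (homogeneity, evaluation, base change,
and «its reduced dehomogenisations off the host chart avoid `T₀`» when `b² − 4ac` is a unit), the one-dimensional regularity lemma
`isRegularLocalRing_quotient_of_ringKrullDim_le_one`, stalk transports for closed subschemes, and ★ `ringKrullDim_eq_three_of_node`: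
at a closed point `x` of the special fibre through which the reduced nose `W̃` is SINGULAR while the host trace `Ẽ ∋ x` is regular and
`𝔪_x` has three generators `(ē, ū, v̄)` with `(ē) ⊆ 𝓘⟨W⟩_x` prime, `dim 𝒪_{G,x} = 3`.
-/

set_option linter.dupNamespace false

noncomputable section

open CategoryTheory CategoryTheory.Limits AlgebraicGeometry TopologicalSpace Topology IsLocalRing
open Literature.AlgebraicGeometry.Resolution
open AlgebraicGeometry.Scheme.IdealSheafData
open Summit.ResolutionOfSingularities.ResolutionOfSingularities.Cruxes.EquisingularLift.StrataSplit

namespace Summit.ResolutionOfSingularities.ResolutionOfSingularities.Cruxes.EquisingularLiftNat.Sections.Equinodal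

open Summit.ResolutionOfSingularities.ResolutionOfSingularities.Cruxes.EquisingularLiftNat.Sections
open MvPolynomial

universe u

/-! ## The nose form `aT₁² + bT₁T₂ + cT₂²` -/

section NoseForm

variable {R : Type u} [CommRing R]

/-- The nose form is a quadratic form. [folklore] -/
theorem noseForm_isHomogeneous (a b cc : R) :
    (C a * X 1 ^ 2 + C b * X 1 * X 2 + C cc * X 2 ^ 2 : MvPolynomial (Fin 3) R).IsHomogeneous 2 := by
  have h2 : (C b * X 1 * X 2 : MvPolynomial (Fin 3) R).IsHomogeneous 2 := by
    have h := ((isHomogeneous_C (Fin 3) b).mul (isHomogeneous_X R (1 : Fin 3))).mul (isHomogeneous_X R (2 : Fin 3))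
    simpa using h
  exact ((isHomogeneous_C_mul_X_pow a 1 2).add h2).add (isHomogeneous_C_mul_X_pow cc 2 2)

/-- Evaluation of the nose form. [folklore] -/
theorem noseForm_eval (c : Fin 3 → R) (a b cc : R) :
    MvPolynomial.eval c (C a * X 1 ^ 2 + C b * X 1 * X 2 + C cc * X 2 ^ 2) = a * c 1 ^ 2 + b * c 1 * c 2 + cc * c 2 ^ 2 := by
  simp only [map_add, map_mul, map_pow, MvPolynomial.eval_C, MvPolynomial.eval_X]

/-- Base change of the nose form. [folklore] -/
theorem noseForm_map {S : Type u} [CommRing S] (f : R →+* S) (a b cc : R) :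
    MvPolynomial.map f (C a * X 1 ^ 2 + C b * X 1 * X 2 + C cc * X 2 ^ 2 : MvPolynomial (Fin 3) R) =
      C (f a) * X 1 ^ 2 + C (f b) * X 1 * X 2 + C (f cc) * X 2 ^ 2 := by
  simp only [map_add, map_mul, map_pow, MvPolynomial.map_C, MvPolynomial.map_X]

/-- A polynomial `ā + b̄X + c̄X²` (resp. `āX² + b̄X + c̄`) over a nontrivial ring with `b̄² − 4āc̄` a unit is nonzero. [folklore] -/
theorem noseForm_coeffs_ne_zero {Q : Type u} [CommRing Q] [Nontrivial Q] {a b cc : Q} (hdisc : IsUnit (b ^ 2 - 4 * a * cc)) :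
    ¬ (a = 0 ∧ b = 0 ∧ cc = 0) := by
  rintro ⟨rfl, rfl, rfl⟩
  simp at hdisc

/-- **The reduced dehomogenisations of the nose form off the host chart avoid `T₀`.** For an ideal `I` with `R/I` nontrivial and
`b² − 4ac` a unit: for `i ≠ 0`, the reduction mod `I` of `Φ₂(T_i := 1)` does not lie in `(T₀)` — it is a nonzero polynomial in the
remaining variable alone. [folklore] -/
theorem noseForm_dehomogenize_notMem (I : Ideal R) [Nontrivial (R ⧸ I)] (a b cc : R) (hdisc : IsUnit (b ^ 2 - 4 * a * cc))
    (i : Fin 3) (hne : (0 : Fin 3) ≠ i) :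
    MvPolynomial.map (Ideal.Quotient.mk I)
        (dehomogenize i (C a * X 1 ^ 2 + C b * X 1 * X 2 + C cc * X 2 ^ 2 : MvPolynomial (Fin 3) R)) ∉
      Ideal.span (MvPolynomial.X '' ({⟨0, hne⟩} : Set {j : Fin 3 // j ≠ i})) := by
  classical
  intro hmem
  have hdisc' : IsUnit ((Ideal.Quotient.mk I b) ^ 2 - 4 * Ideal.Quotient.mk I a * Ideal.Quotient.mk I cc) := by
    have h := hdisc.map (Ideal.Quotient.mk I)
    simp only [map_sub, map_mul, map_pow, map_ofNat] at h
    exact h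
  apply noseForm_coeffs_ne_zero hdisc'
  rw [Set.image_singleton] at hmem
  obtain ⟨G, hG⟩ := Ideal.mem_span_singleton'.mp hmem
  -- which chart: `i = 1` or `i = 2`
  have hi : i = 1 ∨ i = 2 := by
    fin_cases i
    · exact absurd rfl hne
    · exact Or.inl rfl
    · exact Or.inr rfl
  rcases hi with rfl | rfl
  · -- `i = 1`: variables `{T₀, T₂}`; substitute `T₀ ↦ 0`, `T₂ ↦ X`
    set ε : MvPolynomial {j : Fin 3 // j ≠ 1} (R ⧸ I) →ₐ[R ⧸ I] Polynomial (R ⧸ I) :=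
      MvPolynomial.aeval fun j => if (j : Fin 3) = 2 then Polynomial.X else 0 with hε
    have hεv : ε (MvPolynomial.X ⟨0, hne⟩) = 0 := by
      rw [hε, MvPolynomial.aeval_X]; exact if_neg (show (0 : Fin 3) ≠ 2 by decide)
    have h11 : killVar (R := R) (1 : Fin 3) (1 : Fin 3) = 1 := killVar_self _
    have h12 : killVar (R := R) (1 : Fin 3) (2 : Fin 3) = MvPolynomial.X ⟨2, by decide⟩ := killVar_of_ne _ (by decide)
    have hF : MvPolynomial.map (Ideal.Quotient.mk I)
        (dehomogenize (1 : Fin 3) (C a * X 1 ^ 2 + C b * X 1 * X 2 + C cc * X 2 ^ 2 : MvPolynomial (Fin 3) R)) =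
        C (Ideal.Quotient.mk I a) + C (Ideal.Quotient.mk I b) * X ⟨2, by decide⟩ +
          C (Ideal.Quotient.mk I cc) * X ⟨2, by decide⟩ ^ 2 := by
      simp only [dehomogenize, map_add, map_mul, map_pow, MvPolynomial.aeval_C, MvPolynomial.aeval_X, h11, h12,
        MvPolynomial.algebraMap_eq, MvPolynomial.map_C, MvPolynomial.map_X, one_pow, mul_one]
    have hεF : ε (MvPolynomial.map (Ideal.Quotient.mk I)
        (dehomogenize (1 : Fin 3) (C a * X 1 ^ 2 + C b * X 1 * X 2 + C cc * X 2 ^ 2 : MvPolynomial (Fin 3) R))) =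
        Polynomial.C (Ideal.Quotient.mk I a) + Polynomial.C (Ideal.Quotient.mk I b) * Polynomial.X +
          Polynomial.C (Ideal.Quotient.mk I cc) * Polynomial.X ^ 2 := by
      rw [hF, hε]
      simp only [map_add, map_mul, map_pow, MvPolynomial.aeval_C, MvPolynomial.aeval_X, Polynomial.algebraMap_eq]
      simp
    have hzero : Polynomial.C (Ideal.Quotient.mk I a) + Polynomial.C (Ideal.Quotient.mk I b) * Polynomial.X +
        Polynomial.C (Ideal.Quotient.mk I cc) * Polynomial.X ^ 2 = 0 := by
      rw [← hεF, ← hG, map_mul, hεv, mul_zero]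
    have h0 := congrArg (fun P => Polynomial.coeff P 0) hzero
    have h1 := congrArg (fun P => Polynomial.coeff P 1) hzero
    have h2 := congrArg (fun P => Polynomial.coeff P 2) hzero
    simp [Polynomial.coeff_X, Polynomial.coeff_C, Polynomial.coeff_X_pow] at h0 h1 h2
    exact ⟨h0, h1, h2⟩
  · -- `i = 2`: variables `{T₀, T₁}`; substitute `T₀ ↦ 0`, `T₁ ↦ X`
    set ε : MvPolynomial {j : Fin 3 // j ≠ 2} (R ⧸ I) →ₐ[R ⧸ I] Polynomial (R ⧸ I) :=
      MvPolynomial.aeval fun j => if (j : Fin 3) = 1 then Polynomial.X else 0 with hε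
    have hεv : ε (MvPolynomial.X ⟨0, hne⟩) = 0 := by
      rw [hε, MvPolynomial.aeval_X]; exact if_neg (show (0 : Fin 3) ≠ 1 by decide)
    have h22 : killVar (R := R) (2 : Fin 3) (2 : Fin 3) = 1 := killVar_self _
    have h21 : killVar (R := R) (2 : Fin 3) (1 : Fin 3) = MvPolynomial.X ⟨1, by decide⟩ := killVar_of_ne _ (by decide)
    have hF : MvPolynomial.map (Ideal.Quotient.mk I)
        (dehomogenize (2 : Fin 3) (C a * X 1 ^ 2 + C b * X 1 * X 2 + C cc * X 2 ^ 2 : MvPolynomial (Fin 3) R)) =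
        C (Ideal.Quotient.mk I a) * X ⟨1, by decide⟩ ^ 2 + C (Ideal.Quotient.mk I b) * X ⟨1, by decide⟩ +
          C (Ideal.Quotient.mk I cc) := by
      simp only [dehomogenize, map_add, map_mul, map_pow, MvPolynomial.aeval_C, MvPolynomial.aeval_X, h22, h21,
        MvPolynomial.algebraMap_eq, MvPolynomial.map_C, MvPolynomial.map_X, one_pow, mul_one]
    have hεF : ε (MvPolynomial.map (Ideal.Quotient.mk I)
        (dehomogenize (2 : Fin 3) (C a * X 1 ^ 2 + C b * X 1 * X 2 + C cc * X 2 ^ 2 : MvPolynomial (Fin 3) R))) =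
        Polynomial.C (Ideal.Quotient.mk I a) * Polynomial.X ^ 2 + Polynomial.C (Ideal.Quotient.mk I b) * Polynomial.X +
          Polynomial.C (Ideal.Quotient.mk I cc) := by
      rw [hF, hε]
      simp only [map_add, map_mul, map_pow, MvPolynomial.aeval_C, MvPolynomial.aeval_X, Polynomial.algebraMap_eq]
      simp
    have hzero : Polynomial.C (Ideal.Quotient.mk I a) * Polynomial.X ^ 2 + Polynomial.C (Ideal.Quotient.mk I b) * Polynomial.X +
        Polynomial.C (Ideal.Quotient.mk I cc) = 0 := by
      rw [← hεF, ← hG, map_mul, hεv, mul_zero]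
    have h0 := congrArg (fun P => Polynomial.coeff P 0) hzero
    have h1 := congrArg (fun P => Polynomial.coeff P 1) hzero
    have h2 := congrArg (fun P => Polynomial.coeff P 2) hzero
    simp [Polynomial.coeff_X, Polynomial.coeff_C, Polynomial.coeff_X_pow] at h0 h1 h2
    exact ⟨h2, h1, h0⟩

end NoseForm

/-! ## One-dimensional regular local rings have regular prime quotients -/

/-- In a regular local ring of dimension `≤ 1` (a field or a DVR) every prime quotient is regular (it is the ring itself or its
residue field). [cite: Matsumura1987, Thm. 11.2 and §14] -/
theorem isRegularLocalRing_quotient_of_ringKrullDim_le_one {B : Type u} [CommRing B] [IsRegularLocalRing B]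
    (hB : ringKrullDim B ≤ 1) (𝔭 : Ideal B) [𝔭.IsPrime] : IsRegularLocalRing (B ⧸ 𝔭) := by
  haveI : IsDomain B := isDomain_of_isRegularLocalRing B
  haveI : Ring.KrullDimLE 1 B := Ring.krullDimLE_iff.mpr hB
  by_cases h : 𝔭 = ⊥
  · subst h; exact IsRegularLocalRing.of_ringEquiv (RingEquiv.quotientBot B).symm
  · haveI : 𝔭.IsMaximal := Ideal.IsPrime.isMaximal_of_ne_bot ‹_› h
    letI := Ideal.Quotient.field 𝔭
    infer_instance

/-- `(b + 1 = a, a ≤ 3, ¬ b ≤ 1)` in `ℕ` forces `a = 3`. [folklore] -/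
theorem nat_eq_three_of_succ {a b : ℕ} (hab : b + 1 = a) (ha : a ≤ 3) (hb : ¬ b ≤ 1) : a = 3 := by omega

/-! ## Stalks of closed subschemes as quotients (point-named forms) -/

/-- Regularity of `V(I)` at a point `z` over `x` is regularity of `𝒪_{X,x} ⧸ I_x`. [folklore] (tree `isRegularLocalRing_stalk_subscheme_iff`) -/
theorem isRegularLocalRing_subscheme_stalk_iff_of_eq {X : Scheme.{u}} (I : X.IdealSheafData) (z : ↥I.subscheme) (x : X)
    (hz : I.subschemeι z = x) :
    IsRegularLocalRing (I.subscheme.presheaf.stalk z) ↔ IsRegularLocalRing (X.presheaf.stalk x ⧸ stalkIdeal I x) := by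
  subst hz
  exact isRegularLocalRing_stalk_subscheme_iff I z

/-- For `V(I)` integral, `𝒪_{X,x} ⧸ I_x` is a domain at every point `x` of `V(I)`. [folklore] (tree `nonempty_stalkSubschemeEquiv`) -/
theorem isDomain_quotient_stalkIdeal_of_eq {X : Scheme.{u}} (I : X.IdealSheafData) [IsIntegral I.subscheme] (z : ↥I.subscheme)
    (x : X) (hz : I.subschemeι z = x) : IsDomain (X.presheaf.stalk x ⧸ stalkIdeal I x) := by
  subst hz
  exact MulEquiv.isDomain _ (nonempty_stalkSubschemeEquiv I z).some.toMulEquiv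

/-! ## ★ The dimension at the node -/

/-- ★ **`dim 𝒪_{G,x} = 3` at a node of the reduced nose.** Let `A = 𝒪_{G,x}` be a regular local ring whose maximal ideal is generated by
three elements, `ē ∈ 𝔪_A` nonzero with `A/(ē)` regular (the host trace `Ẽ` through `x`), and `𝔞 ⊇ (ē)` a PRIME ideal with `A/𝔞` NOT
regular (the reduced irreducible nose `W̃`, singular at `x`). Then `dim A = 3`: `dim A ≤ 3` by the generators; if `dim A ≤ 2` then
`dim A/(ē) ≤ 1`, and a prime quotient of a regular local ring of dimension `≤ 1` is regular — so `A/𝔞 = (A/(ē))/(𝔞/(ē))` would be regular.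
[cite: Matsumura1987, Thm. 14.2] [OURS · L1 W4.5b · HNODE P6] -/
theorem ringKrullDim_eq_three_of_node {A : Type u} [CommRing A] [IsRegularLocalRing A] {cb : Fin 3 → A}
    (hcb : Ideal.span (Set.range cb) = maximalIdeal A) {eb : A} (heb0 : eb ≠ 0) (hebm : eb ∈ maximalIdeal A)
    (hEreg : IsRegularLocalRing (A ⧸ Ideal.span {eb})) {𝔞 : Ideal A} [𝔞.IsPrime] (hle : Ideal.span {eb} ≤ 𝔞)
    (hsing : ¬ IsRegularLocalRing (A ⧸ 𝔞)) : ringKrullDim A = (3 : ℕ) := by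
  haveI : IsDomain A := isDomain_of_isRegularLocalRing A
  -- `dim A ≤ 3`
  have hle3 : ringKrullDim A ≤ (3 : ℕ) := by
    refine (ringKrullDim_le_spanFinrank_maximalIdeal A).trans ?_
    have h1 : (maximalIdeal A).spanFinrank ≤ 3 := by
      rw [← hcb]
      refine (Submodule.spanFinrank_span_le_ncard_of_finite (Set.finite_range cb)).trans ?_
      rw [← Set.image_univ]
      refine (Set.ncard_image_le (Set.finite_univ)).trans ?_
      rw [Set.ncard_univ, Nat.card_eq_fintype_card, Fintype.card_fin]
    exact_mod_cast h1
  -- `dim A/(ē) + 1 = dim A`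
  have hdimB := ringKrullDim_quotient_span_singleton_succ_eq_ringKrullDim_of_mem_nonZeroDivisors
    (mem_nonZeroDivisors_of_ne_zero heb0) hebm
  -- `¬ dim A/(ē) ≤ 1`
  have hB1 : ¬ ringKrullDim (A ⧸ Ideal.span {eb}) ≤ 1 := by
    intro hB
    haveI := hEreg
    haveI h𝔞' : (𝔞.map (Ideal.Quotient.mk (Ideal.span {eb}))).IsPrime :=
      Ideal.map_isPrime_of_surjective Ideal.Quotient.mk_surjective (by rwa [Ideal.mk_ker])
    have hreg := isRegularLocalRing_quotient_of_ringKrullDim_le_one hB (𝔞.map (Ideal.Quotient.mk (Ideal.span {eb})))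
    exact hsing (IsRegularLocalRing.of_ringEquiv (DoubleQuot.quotQuotEquivQuotOfLE hle))
  -- arithmetic
  haveI := hEreg
  obtain ⟨nA, hnA⟩ := ringKrullDim_eq_nat A
  obtain ⟨nB, hnB⟩ := ringKrullDim_eq_nat (A ⧸ Ideal.span {eb})
  rw [hnA, hnB] at hdimB
  rw [hnA] at hle3
  rw [hnB] at hB1
  have h1 : nB + 1 = nA := by exact_mod_cast hdimB
  have h2 : nA ≤ 3 := by exact_mod_cast hle3
  have h3 : ¬ nB ≤ 1 := fun h => hB1 (by exact_mod_cast h)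
  rw [hnA, nat_eq_three_of_succ h1 h2 h3]

end Summit.ResolutionOfSingularities.ResolutionOfSingularities.Cruxes.EquisingularLiftNat.Sections.Equinodal

end
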